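import Summits.NavierStokesRegularity.NavierStokesRegularity.Theses.AxisymmetricExtremality
import Summits.NavierStokesRegularity.NavierStokesRegularity.Theorems.AxisymmetricExtremalityAxisymmetricKatoGlobalStubSereginLogSwirlOriginStep3LocalApriori
import Summits.NavierStokesRegularity.NavierStokesRegularity.Theorems.AxisymmetricExtremalityAxisymmetricKatoGlobalStubSereginLogSwirlOriginStep3KeyUnconditional
import HarnessLib

/-!
# Seregin 2022, §2 Step 3 for the LOCAL smooth class (VII): the key estimate with the `A₃`-bound
# and Lemma 2.1 (ii) discharged, for a family of smooth axisymmetric fields solving the vorticity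
# equation near the cut-off — crux stmt-NavierStokesRegularity-15453
# (`AxisymmetricExtremality.AxisymmetricKatoGlobal`), line registered, support for stub `stub_sereginLogSwirlOrigin`

Support file (`--supports stmt-NavierStokesRegularity-15453`; theorems only, everything proved)
toward the registered stub `stub_sereginLogSwirlOrigin` = the named fact
`Literature.Analysis.FluidPDE.seregin2022_logSwirl_regularAtOrigin` (G. Seregin, J. Math. Fluid
Mech. 24 (2022), Paper 27 = arXiv:2201.00153, §2), sequel of `…Step3LocalApriori`. The siblings
`…Step3KeyEstimate` (`cutoff_energy_keyEstimate_of_lemma21`) and `…Step3KeyUnconditional`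
(`cutoff_energy_keyEstimate_unconditional`) turn the key estimate in `θ_A/B_A` form into the
final Step-3 output for a whole-space classical solution: the `A₃` bound
`2A₃ ≤ (C₁(1+4c_L)/ln²(e/r₁) + 4ε)D + B_A` (`two_mul_integral_sourcePhi_le`, a fixed-time statement
about a smooth axisymmetric slice) and Lemma 2.1 (ii) in numeric form
(`integral_hessianSq_cutoff_radVelQuot_le_of_pointwise`, likewise fixed-time, with `div v = 0`
only on `tsupport ζ`). Both inputs being slice-wise, the same two passages apply verbatim to the
local class of `cutoff_energy_keyEstimate_local` (a family of globally `C^∞` axisymmetric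
fields, divergence free and solving the vorticity equation on an open `W ⊇ K ⊇ supp ζ`, with
`Γ, DΓ, ∂ₜΓ, Φ, DΦ, ∂ₜΦ` jointly continuous):

* `cutoff_energy_keyEstimate_local_of_lemma21` — the key estimate for the local class with the
  `A₃` bound discharged, Lemma 2.1 (ii) as the numeric hypothesis
  `∫|∇²(ζv_r/r)|² ≤ c_L∫|∇(ζΓ)|² + C_L`; conclusion and constants verbatim those of
  `cutoff_energy_keyEstimate_of_lemma21`;
* `cutoff_energy_keyEstimate_local_unconditional` — **the Step-3 output for the local class**:
  Lemma 2.1 (ii) discharged (`c_L = 3`, `C_L = 3(P₃² + P₄²)V`); hypotheses (2.2), `M`, `Bcut`,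
  `P₀, …, P₄`, `V`, the smallness `8C₁/ln(e/r₁) + 13C₁/ln²(e/r₁) + 4ε < 2ν`, conclusion
  `sup_{[t₁,t₂]} E ≤ K`, `∫_{t₁}^{t₂} D ≤ K/(2ν − 8C₁/L − (13C₁/L² + 4ε))` and the constant `K`
  VERBATIM those of `cutoff_energy_keyEstimate_unconditional` — only the solution class differs.

The sequel `…Step3LocalKeyEstimate` derives the joint-continuity hypotheses from the joint
continuity of the spatial derivatives and specialises to the Seregin–Zajaczkowski representative.

## Mathlib / tree search

Tree: `cutoff_energy_keyEstimate_of_lemma21` (`…Step3KeyEstimate`),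
`cutoff_energy_keyEstimate_unconditional`, `integral_hessianSq_cutoff_radVelQuot_le_of_pointwise`
(`…Step3KeyUnconditional`), `two_mul_integral_sourcePhi_le` (`…Step3SourcePhi`),
`cutoff_energy_keyEstimate_local` (`…Step3LocalApriori`), `log_exp_div_eq`.
`lean search 'keyEstimate_local' --decl`: only `…Step3LocalApriori` (2026-08-17).

## References

* G. Seregin, J. Math. Fluid Mech. 24 (2022), Paper No. 27 = arXiv:2201.00153, §2 Step 3
  (arXiv p. 7, the key estimate) and Lemma 2.1 (p. 5). [`Seregin2022LocalAxisym`]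
-/

noncomputable section

open MeasureTheory Set Filter Topology Function Metric intervalIntegral
open scoped ENNReal ContDiff Laplacian
open Literature.Analysis.FluidPDE

-- `<Problem> = <Summit>` duplicates a namespace component by design (lakefile sets the same option).
set_option linter.dupNamespace false

namespace Summit.NavierStokesRegularity.NavierStokesRegularity.Theorems.AxisymmetricKatoGlobal.EulerScaling

/-- **Seregin 2022, §2 Step 3, the key estimate for the LOCAL smooth class with the `A₃`-bound
discharged, assuming Lemma 2.1 (ii) in numeric form** — the statement of
`cutoff_energy_keyEstimate_of_lemma21` with the classical solution replaced by the local class of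
`cutoff_energy_keyEstimate_local` (family of globally `C^∞` axisymmetric fields; `div v = 0` and
the pointwise vorticity equation off the axis on an open `W ⊇ K ⊇ supp ζ`; joint continuity of
`Γ, ∂ₜΓ, DΓ, Φ, ∂ₜΦ, DΦ`). Conclusion and constants verbatim.
[cite: Seregin2022LocalAxisym, §2 Step 3 (arXiv:2201.00153 p. 7, the key estimate "sup ∫η⁶(|Γ|²+|Φ|²) + ∫∫(η³|∇Φ|)²+(η³|∇Γ|)² ≤ C(v,η,r₁)")] -/
theorem cutoff_energy_keyEstimate_local_of_lemma21 : ∀ (a b ν : ℝ) (v : ℝ → EuclideanSpace ℝ (Fin 3) → EuclideanSpace ℝ (Fin 3)) (ζ : ℝ → EuclideanSpace ℝ (Fin 3) → ℝ) (K W : Set (EuclideanSpace ℝ (Fin 3))) (t₁ t₂ C₁ r₁ M Bcut ε P₀ P₁ P₂ cL CL V : ℝ), (∀ s ∈ Ioo a b, ContDiff ℝ (⊤ : ℕ∞) (v s)) → (∀ s ∈ Ioo a b, IsAxisymmetric (v s)) → 0 ≤ ν → IsSmoothSpaceTimeOn (Ioo a b) ζ → (∀ s ∈ Ioo a b, IsAxisymmetricScalar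 (ζ s)) → (∀ s ∈ Ioo a b, tsupport (ζ s) ⊆ SereginSverak2009.spaceCyl 0 1) → Icc t₁ t₂ ⊆ Ioo a b → IsCompact K → (∀ s ∈ Ioo a b, ∀ x ∉ K, ζ s x = 0) → IsOpen W → K ⊆ W → (∀ s ∈ Ioo a b, ∀ x ∈ W, VectorCalculus.divergence (v s) x = 0) → (∀ s ∈ Ioo a b, ∀ x ∈ W, cylRadius x ≠ 0 → HasDerivAt (fun s' => curl (v s') x) (ν • (Δ (curl (v s))) x - fderiv ℝ (curl (v s)) x (v s x) + fderiv ℝ (v s) x (curl (v s) x)) s) → ContinuousOn (fun z : ℝ × EuclideanSpace ℝ (Fin 3) => angVortQuot (v z.1) z.2) (Ioo a b ×ˢ univ) → ContinuousOn (fun z : ℝ × EuclideanSpace ℝ (Fin 3) => angVelQuot (fun y => ν • (Δ (curl (v z.1))) y - fderiv ℝ (curl (v z.1)) y (v z.1 y) + fderiv ℝ (v z.1) y (curl (v z.1) y)) z.2) (Ioo a b ×ˢ univ) → ContinuousOn (fun z : ℝ × EuclideanSpace ℝ (Fin 3) => fderiv ℝ (angVortQuot (v z.1)) z.2) (Ioo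 a b ×ˢ univ) → ContinuousOn (fun z : ℝ × EuclideanSpace ℝ (Fin 3) => radVelQuot (curl (v z.1)) z.2) (Ioo a b ×ˢ univ) → ContinuousOn (fun z : ℝ × EuclideanSpace ℝ (Fin 3) => radVelQuot (fun y => ν • (Δ (curl (v z.1))) y - fderiv ℝ (curl (v z.1)) y (v z.1 y) + fderiv ℝ (v z.1) y (curl (v z.1) y)) z.2) (Ioo a b ×ˢ univ) → ContinuousOn (fun z : ℝ × EuclideanSpace ℝ (Fin 3) => fderiv ℝ (radVelQuot (curl (v z.1))) z.2) (Ioo a b ×ˢ univ) → t₁ ≤ t₂ → 0 ≤ C₁ → 0 < r₁ → r₁ < 1 → 0 ≤ M → 0 ≤ Bcut → 0 < ε → 0 ≤ P₂ → 0 ≤ cL → 0 ≤ CL → volume.real (closedBall (0 : EuclideanSpace ℝ (Fin 3)) 2) ≤ V → (∀ t ∈ Icc t₁ t₂, ∀ x, 0 < cylRadius x → cylRadius x < r₁ → |swirl (v t) x| ≤ C₁ / Real.log (Real.exp 1 / cylRadius x) ^ 3) → (∀ t ∈ Icc t₁ t₂, ∀ x, r₁ ≤ cylRadius x → |angVelQuot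 (v t) x * (ζ t x * angVortQuot (v t) x) * (ζ t x * radVelQuot (curl (v t)) x)| ≤ M) → (∀ t ∈ Icc t₁ t₂, (2 * (∫ x, ζ t x * timeDerivWithin (Ioo a b) ζ t x * angVortQuot (v t) x ^ 2) + 2 * (∫ x, ζ t x * angVortQuot (v t) x ^ 2 * fderiv ℝ (ζ t) x (v t x)) + 2 * ν * (∫ x, angVortQuot (v t) x ^ 2 * (fderiv ℝ (ζ t) x (EuclideanSpace.single 0 1) ^ 2 + fderiv ℝ (ζ t) x (EuclideanSpace.single 1 1) ^ 2 + fderiv ℝ (ζ t) x (EuclideanSpace.single 2 1) ^ 2)) - 4 * ν * (∫ x, ζ t x * angVortQuot (v t) x ^ 2 * radDerivQuot (ζ t) x)) + (2 * (∫ x, ζ t x * timeDerivWithin (Ioo a b) ζ t x * radVelQuot (curl (v t)) x ^ 2) + 2 * (∫ x, ζ t x * radVelQuot (curl (v t)) x ^ 2 * fderiv ℝ (ζ t) x (v t x)) + 2 * ν * (∫ x, radVelQuot (curl (v t)) x ^ 2 * (fderiv ℝ (ζ t) x (EuclideanSpace.single 0 1) ^ 2 + fderiv ℝ (ζ t) x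 (EuclideanSpace.single 1 1) ^ 2 + fderiv ℝ (ζ t) x (EuclideanSpace.single 2 1) ^ 2)) - 4 * ν * (∫ x, ζ t x * radVelQuot (curl (v t)) x ^ 2 * radDerivQuot (ζ t) x)) ≤ Bcut) → (∀ t ∈ Icc t₁ t₂, ∀ x, r₁ ≤ cylRadius x → |swirlVelocity (v t) x| * ‖fderiv ℝ (fun y => ζ t y * radVelQuot (v t) y) x‖ ≤ P₀) → (∀ t ∈ Icc t₁ t₂, ∀ x, |radVelQuot (v t) x| * |swirlVelocity (v t) x| * ‖fderiv ℝ (ζ t) x‖ ≤ P₁) → (∀ t ∈ Icc t₁ t₂, ∀ x, |ζ t x * radVelQuot (curl (v t)) x| * |swirlVelocity (v t) x| * (‖fderiv ℝ (ζ t) x‖ * ‖fderiv ℝ (radVelQuot (v t)) x‖) ≤ P₂) → (∀ t ∈ Icc t₁ t₂, (∫ x, ∑ i : Fin 3, ∑ j : Fin 3, (fderiv ℝ (fun y => fderiv ℝ (fun y => ζ t y * radVelQuot (v t) y) y (EuclideanSpace.single i 1)) x (EuclideanSpace.single j 1)) ^ 2) ≤ cL * (∫ x, (fderiv ℝ (fun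 y => ζ t y * angVortQuot (v t) y) x (EuclideanSpace.single 0 1) ^ 2 + fderiv ℝ (fun y => ζ t y * angVortQuot (v t) y) x (EuclideanSpace.single 1 1) ^ 2 + fderiv ℝ (fun y => ζ t y * angVortQuot (v t) y) x (EuclideanSpace.single 2 1) ^ 2)) + CL) → 8 * C₁ / Real.log (Real.exp 1 / r₁) + (C₁ * (1 + 4 * cL) / Real.log (Real.exp 1 / r₁) ^ 2 + 4 * ε) < 2 * ν → (∀ t ∈ Icc t₁ t₂, (∫ x, (ζ t x * angVortQuot (v t) x) ^ 2) + (∫ x, (ζ t x * radVelQuot (curl (v t)) x) ^ 2) ≤ (∫ x, (ζ t₁ x * angVortQuot (v t₁) x) ^ 2) + (∫ x, (ζ t₁ x * radVelQuot (curl (v t₁)) x) ^ 2) + (Bcut + (4 * C₁ * CL / Real.log (Real.exp 1 / r₁) ^ 2 + ((P₀ ^ 2 + P₁ ^ 2) / (2 * ε) + 2 * P₂) * V) + 4 * M * V) * (t₂ - t₁)) ∧ ∫ s in t₁..t₂, ((∫ x, (fderiv ℝ (fun y => ζ s y * angVortQuot (v s) y) x (EuclideanSpace.single 0 1) ^ 2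 + fderiv ℝ (fun y => ζ s y * angVortQuot (v s) y) x (EuclideanSpace.single 1 1) ^ 2 + fderiv ℝ (fun y => ζ s y * angVortQuot (v s) y) x (EuclideanSpace.single 2 1) ^ 2)) + (∫ x, (fderiv ℝ (fun y => ζ s y * radVelQuot (curl (v s)) y) x (EuclideanSpace.single 0 1) ^ 2 + fderiv ℝ (fun y => ζ s y * radVelQuot (curl (v s)) y) x (EuclideanSpace.single 1 1) ^ 2 + fderiv ℝ (fun y => ζ s y * radVelQuot (curl (v s)) y) x (EuclideanSpace.single 2 1) ^ 2))) ≤ ((∫ x, (ζ t₁ x * angVortQuot (v t₁) x) ^ 2) + (∫ x, (ζ t₁ x * radVelQuot (curl (v t₁)) x) ^ 2) + (Bcut + (4 * C₁ * CL / Real.log (Real.exp 1 / r₁) ^ 2 + ((P₀ ^ 2 + P₁ ^ 2) / (2 * ε) + 2 * P₂) * V) + 4 * M * V) * (t₂ - t₁)) / (2 * ν - 8 * C₁ / Real.log (Real.exp 1 / r₁) - (C₁ * (1 + 4 * cL) / Real.log (Real.exp 1 / r₁) ^ 2 + 4 * ε)) := by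
  intro a b ν v ζ K W t₁ t₂ C₁ r₁ M Bcut ε P₀ P₁ P₂ cL CL V hu hax hν hζ hζax hζs hsub hK hsupp hWo hKW hdiv hvort hΓc hΓ'c hDΓc hJc hJ'c hDJc h12 hC₁ hr₁ hr₁1 hM hBcut hε hP₂ hcL hCL hV hσ hfar hcut hP0 hP1 hP2 hL21 hsmall
  have hVOL : 0 ≤ volume.real (closedBall (0 : EuclideanSpace ℝ (Fin 3)) 2) := measureReal_nonneg
  have hL₁0 : 0 < Real.log (Real.exp 1 / r₁) := by
    rw [log_exp_div_eq r₁ hr₁]; linarith [Real.log_neg hr₁ hr₁1]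
  have hBA : 0 ≤ (4 * C₁ * CL / Real.log (Real.exp 1 / r₁) ^ 2 + ((P₀ ^ 2 + P₁ ^ 2) / (2 * ε) + 2 * P₂) * volume.real (closedBall (0 : EuclideanSpace ℝ (Fin 3)) 2)) := by positivity
  have hA3 : ∀ t ∈ Icc t₁ t₂, 2 * (∫ x, ζ t x ^ 2 * radVelQuot (curl (v t)) x * fderiv ℝ (radVelQuot (v t)) x (curl (v t) x)) ≤
      (C₁ * (1 + 4 * cL) / Real.log (Real.exp 1 / r₁) ^ 2 + 4 * ε) * ((∫ x, (fderiv ℝ (fun y => ζ t y * angVortQuot (v t) y) x (EuclideanSpace.single 0 1) ^ 2 + fderiv ℝ (fun y => ζ t y * angVortQuot (v t) y) x (EuclideanSpace.single 1 1) ^ 2 + fderiv ℝ (fun y => ζ t y * angVortQuot (v t) y) x (EuclideanSpace.single 2 1) ^ 2)) + (∫ x, (fderiv ℝ (fun y => ζ t y * radVelQuot (curl (v t)) y) x (EuclideanSpace.single 0 1) ^ 2 + fderiv ℝ (fun y => ζ t y * radVelQuot (curl (v t)) y) x (EuclideanSpace.single 1 1) ^ 2 + fderiv ℝ (fun y =>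 ζ t y * radVelQuot (curl (v t)) y) x (EuclideanSpace.single 2 1) ^ 2))) + (4 * C₁ * CL / Real.log (Real.exp 1 / r₁) ^ 2 + ((P₀ ^ 2 + P₁ ^ 2) / (2 * ε) + 2 * P₂) * volume.real (closedBall (0 : EuclideanSpace ℝ (Fin 3)) 2)) := by
    intro t ht
    have hts : t ∈ Ioo a b := hsub ht
    have hv4 : ContDiff ℝ 4 (v t) := (hu t hts).of_le (by norm_cast)
    have hζ2 : ContDiff ℝ 2 (ζ t) := (hζ.contDiff_slice hts).of_le (by norm_cast)
    exact two_mul_integral_sourcePhi_le (v t) (ζ t) C₁ r₁ ε P₀ P₁ P₂ cL CL (hax t hts) hv4 hζ2 (hζax t hts)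
      (hζs t hts) hC₁ hr₁ hr₁1 hε hP₂ hcL (hσ t ht) (hP0 t ht) (hP1 t ht) (hP2 t ht) (hL21 t ht)
  obtain ⟨hsup, hdiss⟩ := cutoff_energy_keyEstimate_local a b ν v ζ K W t₁ t₂ C₁ r₁ M (C₁ * (1 + 4 * cL) / Real.log (Real.exp 1 / r₁) ^ 2 + 4 * ε) (4 * C₁ * CL / Real.log (Real.exp 1 / r₁) ^ 2 + ((P₀ ^ 2 + P₁ ^ 2) / (2 * ε) + 2 * P₂) * volume.real (closedBall (0 : EuclideanSpace ℝ (Fin 3)) 2)) Bcut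
    hu hax hν hζ hζax hζs hsub hK hsupp hWo hKW hdiv hvort hΓc hΓ'c hDΓc hJc hJ'c hDJc hC₁ hr₁ hr₁1 hM hσ hfar hcut hA3 hBcut hBA hsmall h12
  -- replace the ball volume by its upper bound `V`
  have hcoef : 0 ≤ (P₀ ^ 2 + P₁ ^ 2) / (2 * ε) + 2 * P₂ := by positivity
  have hmono : (Bcut + (4 * C₁ * CL / Real.log (Real.exp 1 / r₁) ^ 2 + ((P₀ ^ 2 + P₁ ^ 2) / (2 * ε) + 2 * P₂) * volume.real (closedBall (0 : EuclideanSpace ℝ (Fin 3)) 2)) + 4 * M * volume.real (closedBall (0 : EuclideanSpace ℝ (Fin 3)) 2)) * (t₂ - t₁) ≤ (Bcut + (4 * C₁ * CL / Real.log (Real.exp 1 / r₁) ^ 2 + ((P₀ ^ 2 + P₁ ^ 2) / (2 * ε) + 2 * P₂) * V) + 4 * M * V) * (t₂ - t₁) := by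
    apply mul_le_mul_of_nonneg_right _ (by linarith)
    nlinarith [mul_le_mul_of_nonneg_left hV hcoef, mul_le_mul_of_nonneg_left hV hM]
  have hpos : 0 < 2 * ν - 8 * C₁ / Real.log (Real.exp 1 / r₁) - (C₁ * (1 + 4 * cL) / Real.log (Real.exp 1 / r₁) ^ 2 + 4 * ε) := by linarith
  refine ⟨fun t ht => (hsup t ht).trans (by linarith), hdiss.trans ?_⟩
  exact div_le_div_of_nonneg_right (by linarith) hpos.le

/-- **Seregin 2022, §2 Step 3, the key estimate for the LOCAL smooth class, unconditional form**
(the Step-3 output consumed by Step 4): the statement of `cutoff_energy_keyEstimate_unconditional`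
with the whole-space classical solution `IsClassicalNSSolutionOn (Ioo a b) ν 0 v q` replaced by
a family `v` of globally `C^∞` axisymmetric fields on `(a, b)` which is divergence free and solves
the vorticity equation pointwise off the axis on an open `W` containing the compact `K` off which
`ζ` vanishes (`d/ds curl (v s) x = νΔω − Dω[v] + Dv[ω]`), together with the joint continuity on
the slab of `Γ = angVortQuot`, `Φ = radVelQuot ∘ curl`, their gradients and the quotients
`angVelQuot W`, `radVelQuot W` of the vorticity right-hand side (their time derivatives off the
axis). Hypotheses (2.2)/`M`/`Bcut`/`P₀…P₄`/`V`, the smallness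
`8C₁/ln(e/r₁) + 13C₁/ln²(e/r₁) + 4ε < 2ν`, the conclusion `sup_{[t₁,t₂]}(∫(ζΓ)² + ∫(ζΦ)²) ≤ K`,
`∫_{t₁}^{t₂}(∫|∇(ζΓ)|² + ∫|∇(ζΦ)|²) ≤ K/(2ν − 8C₁/L − (13C₁/L² + 4ε))` and the constant
`K = E(t₁) + (Bcut + (12C₁(P₃² + P₄²)V/L² + ((P₀² + P₁²)/(2ε) + 2P₂)V) + 4MV)(t₂ − t₁)` are
verbatim those of the classical version. [cite: Seregin2022LocalAxisym, §2 Step 3 (arXiv:2201.00153 p. 7, the key estimate) and Lemma 2.1 (p. 5)] -/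
theorem cutoff_energy_keyEstimate_local_unconditional : ∀ (a b ν : ℝ) (v : ℝ → EuclideanSpace ℝ (Fin 3) → EuclideanSpace ℝ (Fin 3)) (ζ : ℝ → EuclideanSpace ℝ (Fin 3) → ℝ) (K W : Set (EuclideanSpace ℝ (Fin 3))) (t₁ t₂ C₁ r₁ M Bcut ε P₀ P₁ P₂ P₃ P₄ V : ℝ), (∀ s ∈ Ioo a b, ContDiff ℝ (⊤ : ℕ∞) (v s)) → (∀ s ∈ Ioo a b, IsAxisymmetric (v s)) → 0 ≤ ν → IsSmoothSpaceTimeOn (Ioo a b) ζ → (∀ s ∈ Ioo a b, IsAxisymmetricScalar (ζ s)) → (∀ s ∈ Ioo a b, tsupport (ζ s) ⊆ SereginSverak2009.spaceCyl 0 1) → Icc t₁ t₂ ⊆ Ioo a b → IsCompact K → (∀ s ∈ Ioo a b, ∀ x ∉ K, ζ s x = 0) → IsOpen W → K ⊆ W → (∀ s ∈ Ioo a b, ∀ x ∈ W, VectorCalculus.divergence (v s) x = 0) → (∀ s ∈ Ioo a b, ∀ x ∈ W, cylRadius x ≠ 0 → HasDerivAt (fun s' => curl (v s') x) (ν • (Δ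 (curl (v s))) x - fderiv ℝ (curl (v s)) x (v s x) + fderiv ℝ (v s) x (curl (v s) x)) s) → ContinuousOn (fun z : ℝ × EuclideanSpace ℝ (Fin 3) => angVortQuot (v z.1) z.2) (Ioo a b ×ˢ univ) → ContinuousOn (fun z : ℝ × EuclideanSpace ℝ (Fin 3) => angVelQuot (fun y => ν • (Δ (curl (v z.1))) y - fderiv ℝ (curl (v z.1)) y (v z.1 y) + fderiv ℝ (v z.1) y (curl (v z.1) y)) z.2) (Ioo a b ×ˢ univ) → ContinuousOn (fun z : ℝ × EuclideanSpace ℝ (Fin 3) => fderiv ℝ (angVortQuot (v z.1)) z.2) (Ioo a b ×ˢ univ) → ContinuousOn (fun z : ℝ × EuclideanSpace ℝ (Fin 3) => radVelQuot (curl (v z.1)) z.2) (Ioo a b ×ˢ univ) → ContinuousOn (fun z : ℝ × EuclideanSpace ℝ (Fin 3) => radVelQuot (fun y => ν • (Δ (curl (v z.1))) y - fderiv ℝ (curl (v z.1)) y (v z.1 y) + fderiv ℝ (v z.1) y (curl (v z.1) y)) z.2) (Ioo a b ×ˢ univ) → ContinuousOn (fun z : ℝ × EuclideanSpace ℝ (Fin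 3) => fderiv ℝ (radVelQuot (curl (v z.1))) z.2) (Ioo a b ×ˢ univ) → t₁ ≤ t₂ → 0 ≤ C₁ → 0 < r₁ → r₁ < 1 → 0 ≤ M → 0 ≤ Bcut → 0 < ε → 0 ≤ P₂ → volume.real (closedBall (0 : EuclideanSpace ℝ (Fin 3)) 2) ≤ V → (∀ t ∈ Icc t₁ t₂, ∀ x, 0 < cylRadius x → cylRadius x < r₁ → |swirl (v t) x| ≤ C₁ / Real.log (Real.exp 1 / cylRadius x) ^ 3) → (∀ t ∈ Icc t₁ t₂, ∀ x, r₁ ≤ cylRadius x → |angVelQuot (v t) x * (ζ t x * angVortQuot (v t) x) * (ζ t x * radVelQuot (curl (v t)) x)| ≤ M) → (∀ t ∈ Icc t₁ t₂, (2 * (∫ x, ζ t x * timeDerivWithin (Ioo a b) ζ t x * angVortQuot (v t) x ^ 2) + 2 * (∫ x, ζ t x * angVortQuot (v t) x ^ 2 * fderiv ℝ (ζ t) x (v t x)) + 2 * ν * (∫ x, angVortQuot (v t) x ^ 2 * (fderiv ℝ (ζ t) x (EuclideanSpace.single 0 1) ^ 2 + fderiv ℝ (ζ t) x (EuclideanSpace.single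 1 1) ^ 2 + fderiv ℝ (ζ t) x (EuclideanSpace.single 2 1) ^ 2)) - 4 * ν * (∫ x, ζ t x * angVortQuot (v t) x ^ 2 * radDerivQuot (ζ t) x)) + (2 * (∫ x, ζ t x * timeDerivWithin (Ioo a b) ζ t x * radVelQuot (curl (v t)) x ^ 2) + 2 * (∫ x, ζ t x * radVelQuot (curl (v t)) x ^ 2 * fderiv ℝ (ζ t) x (v t x)) + 2 * ν * (∫ x, radVelQuot (curl (v t)) x ^ 2 * (fderiv ℝ (ζ t) x (EuclideanSpace.single 0 1) ^ 2 + fderiv ℝ (ζ t) x (EuclideanSpace.single 1 1) ^ 2 + fderiv ℝ (ζ t) x (EuclideanSpace.single 2 1) ^ 2)) - 4 * ν * (∫ x, ζ t x * radVelQuot (curl (v t)) x ^ 2 * radDerivQuot (ζ t) x)) ≤ Bcut) → (∀ t ∈ Icc t₁ t₂, ∀ x, r₁ ≤ cylRadius x → |swirlVelocity (v t) x| * ‖fderiv ℝ (fun y => ζ t y * radVelQuot (v t) y) x‖ ≤ P₀) → (∀ t ∈ Icc t₁ t₂, ∀ x, |radVelQuot (v t) x| * |swirlVelocity (v t) x|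 * ‖fderiv ℝ (ζ t) x‖ ≤ P₁) → (∀ t ∈ Icc t₁ t₂, ∀ x, |ζ t x * radVelQuot (curl (v t)) x| * |swirlVelocity (v t) x| * (‖fderiv ℝ (ζ t) x‖ * ‖fderiv ℝ (radVelQuot (v t)) x‖) ≤ P₂) → (∀ t ∈ Icc t₁ t₂, ∀ x, fderiv ℝ (ζ t) x ≠ 0 → |fderiv ℝ (fun y => fderiv ℝ (ζ t) y (EuclideanSpace.single 2 1) * radVelQuot (v t) y - radDerivQuot (ζ t) y * v t y 2) x (EuclideanSpace.single 2 1)| ≤ P₃) → (∀ t ∈ Icc t₁ t₂, ∀ x, fderiv ℝ (ζ t) x ≠ 0 → |radDerivQuot (fun y => fderiv ℝ (ζ t) y (v t y)) x| ≤ P₄) → 8 * C₁ / Real.log (Real.exp 1 / r₁) + (13 * C₁ / Real.log (Real.exp 1 / r₁) ^ 2 + 4 * ε) < 2 * ν → (∀ t ∈ Icc t₁ t₂, (∫ x, (ζ t x * angVortQuot (v t) x) ^ 2) + (∫ x, (ζ t x * radVelQuot (curl (v t)) x) ^ 2) ≤ (∫ x, (ζ t₁ x * angVortQuot (v t₁)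 x) ^ 2) + (∫ x, (ζ t₁ x * radVelQuot (curl (v t₁)) x) ^ 2) + (Bcut + (12 * C₁ * (P₃ ^ 2 + P₄ ^ 2) * V / Real.log (Real.exp 1 / r₁) ^ 2 + ((P₀ ^ 2 + P₁ ^ 2) / (2 * ε) + 2 * P₂) * V) + 4 * M * V) * (t₂ - t₁)) ∧ ∫ s in t₁..t₂, ((∫ x, (fderiv ℝ (fun y => ζ s y * angVortQuot (v s) y) x (EuclideanSpace.single 0 1) ^ 2 + fderiv ℝ (fun y => ζ s y * angVortQuot (v s) y) x (EuclideanSpace.single 1 1) ^ 2 + fderiv ℝ (fun y => ζ s y * angVortQuot (v s) y) x (EuclideanSpace.single 2 1) ^ 2)) + (∫ x, (fderiv ℝ (fun y => ζ s y * radVelQuot (curl (v s)) y) x (EuclideanSpace.single 0 1) ^ 2 + fderiv ℝ (fun y => ζ s y * radVelQuot (curl (v s)) y) x (EuclideanSpace.single 1 1) ^ 2 + fderiv ℝ (fun y => ζ s y * radVelQuot (curl (v s)) y) x (EuclideanSpace.single 2 1) ^ 2))) ≤ ((∫ x, (ζ t₁ x * angVortQuot (v t₁) x) ^ 2) + (∫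 x, (ζ t₁ x * radVelQuot (curl (v t₁)) x) ^ 2) + (Bcut + (12 * C₁ * (P₃ ^ 2 + P₄ ^ 2) * V / Real.log (Real.exp 1 / r₁) ^ 2 + ((P₀ ^ 2 + P₁ ^ 2) / (2 * ε) + 2 * P₂) * V) + 4 * M * V) * (t₂ - t₁)) / (2 * ν - 8 * C₁ / Real.log (Real.exp 1 / r₁) - (13 * C₁ / Real.log (Real.exp 1 / r₁) ^ 2 + 4 * ε)) := by
  intro a b ν v ζ K W t₁ t₂ C₁ r₁ M Bcut ε P₀ P₁ P₂ P₃ P₄ V hu hax hν hζ hζax hζs hsub hK hsupp hWo hKW hdiv hvort hΓc hΓ'c hDΓc hJc hJ'c hDJc h12 hC₁ hr₁ hr₁1 hM hBcut hε hP₂ hV hσ hfar hcut hP0 hP1 hP2 hP3 hP4 hsmall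
  have hVOL : 0 ≤ volume.real (closedBall (0 : EuclideanSpace ℝ (Fin 3)) 2) := measureReal_nonneg
  have hV0 : 0 ≤ V := hVOL.trans hV
  have hCL : 0 ≤ 3 * (P₃ ^ 2 + P₄ ^ 2) * V := mul_nonneg (by positivity) hV0
  -- Lemma 2.1 (ii), numeric form, at every `t ∈ [t₁, t₂]`
  have hL21 : ∀ t ∈ Icc t₁ t₂, (∫ x, ∑ i : Fin 3, ∑ j : Fin 3, (fderiv ℝ (fun y => fderiv ℝ (fun y => ζ t y * radVelQuot (v t) y) y (EuclideanSpace.single i 1)) x (EuclideanSpace.single j 1)) ^ 2) ≤ 3 * (∫ x, (fderiv ℝ (fun y => ζ t y * angVortQuot (v t) y) x (EuclideanSpace.single 0 1) ^ 2 + fderiv ℝ (fun y => ζ t y * angVortQuot (v t) y) x (EuclideanSpace.single 1 1) ^ 2 + fderiv ℝ (fun y => ζ t y * angVortQuot (v t) y) x (EuclideanSpace.single 2 1) ^ 2)) + 3 * (P₃ ^ 2 + P₄ ^ 2) * V := by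
    intro t ht
    have hts : t ∈ Ioo a b := hsub ht
    have hv5 : ContDiff ℝ 5 (v t) := (hu t hts).of_le (by norm_cast)
    have hζ5 : ContDiff ℝ 5 (ζ t) := (hζ.contDiff_slice hts).of_le (by norm_cast)
    have hKt : tsupport (ζ t) ⊆ K :=
      closure_minimal (fun y hy => by_contra fun h => hy (hsupp t hts y h)) hK.isClosed
    have hdivt : ∀ y ∈ tsupport (ζ t), VectorCalculus.divergence (v t) y = 0 := fun y hy =>
      hdiv t hts y (hKW (hKt hy))
    exact integral_hessianSq_cutoff_radVelQuot_le_of_pointwise hζ5 (hζax t hts) (hζs t hts) hv5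
      (hax t hts) hdivt hV (hP3 t ht) (hP4 t ht)
  have hsmall' : 8 * C₁ / Real.log (Real.exp 1 / r₁) + (C₁ * (1 + 4 * 3) / Real.log (Real.exp 1 / r₁) ^ 2 + 4 * ε) < 2 * ν := by
    have e : C₁ * (1 + 4 * 3) = 13 * C₁ := by ring
    rw [e]; exact hsmall
  obtain ⟨hsup, hdiss⟩ := cutoff_energy_keyEstimate_local_of_lemma21 a b ν v ζ K W t₁ t₂ C₁ r₁ M Bcut ε P₀ P₁ P₂ 3 (3 * (P₃ ^ 2 + P₄ ^ 2) * V) V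
    hu hax hν hζ hζax hζs hsub hK hsupp hWo hKW hdiv hvort hΓc hΓ'c hDΓc hJc hJ'c hDJc h12 hC₁ hr₁ hr₁1 hM hBcut hε hP₂ (by norm_num) hCL hV hσ hfar hcut hP0 hP1 hP2 hL21 hsmall'
  have e1 : C₁ * (1 + 4 * 3) = 13 * C₁ := by ring
  have e2 : 4 * C₁ * (3 * (P₃ ^ 2 + P₄ ^ 2) * V) = 12 * C₁ * (P₃ ^ 2 + P₄ ^ 2) * V := by ring
  simp only [e1, e2] at hsup hdiss
  exact ⟨hsup, hdiss⟩

end Summit.NavierStokesRegularity.NavierStokesRegularity.Theorems.AxisymmetricKatoGlobal.EulerScaling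

end
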